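import Literature.Algebra.Polynomial.CasasAlvero.PurePower
import HarnessLib

/-!
# Casas-Alvero FAILS in degree p + 1 in characteristic p (Graf von Bothmer–Labs–Schicho–van de Woestijne, Prop. 7)

`X^(p+1) - X^p = X^p (X - 1)` shares the root `0` with its Hasse derivatives `D^{(i)}`, `0 < i < p` (because `C(p, i) ≡ 0`),
and the root `1` with `D^{(p)} = (p+1) X - 1 = X - 1`; it is not a `(p+1)`-st power.  Hence `¬ HoldsInDegree K (p + 1)` for EVERY
field `K` of characteristic `p` — the hypotheses `p ∤ …` in `Induction.lean` / `Degree4.lean` (e.g. `6 ≠ 0` in degree 3: fails for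
`p = 2`, degree `3 = p + 1`) are not removable. [cite: GrafVonBothmerEtAl2007, Prop. 7]
-/

noncomputable section

open Polynomial

namespace Literature.Algebra.Polynomial.CasasAlvero

/-- `D^{(i)} X^n = C(n,i) · X^(n-i)` over any commutative ring. [folklore] -/
theorem hasseDeriv_X_pow {R : Type*} [CommRing R] (n i : ℕ) :
    hasseDeriv i ((X : R[X]) ^ n) = C (n.choose i : R) * X ^ (n - i) := by
  simpa using hasseDeriv_X_sub_C_pow (0 : R) n i

variable (K : Type*) [Field K] (p : ℕ) [Fact p.Prime] [CharP K p]

omit [Fact p.Prime] [CharP K p] in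
/-- `X^(p+1) - X^p` has degree `p + 1`. [folklore] -/
theorem natDegree_counterexample : ((X : K[X]) ^ (p + 1) - X ^ p).natDegree = p + 1 := by
  rw [natDegree_sub_eq_left_of_natDegree_lt] <;> simp

omit [Fact p.Prime] [CharP K p] in
/-- `X^(p+1) - X^p` is monic. [folklore] -/
theorem monic_counterexample : ((X : K[X]) ^ (p + 1) - X ^ p).Monic := by
  apply Monic.sub_of_left (monic_X_pow _)
  rw [degree_X_pow, degree_X_pow]
  exact_mod_cast Nat.lt_succ_self p

/-- GvBLSW's counter-example `X^(p+1) - X^p` is Casas-Alvero over every field of characteristic `p`.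
[cite: GrafVonBothmerEtAl2007, Prop. 7] -/
theorem isCasasAlvero_counterexample : IsCasasAlvero ((X : K[X]) ^ (p + 1) - X ^ p) := by
  have hp : p.Prime := Fact.out
  have hp2 := hp.two_le
  intro i hi0 hi
  rw [natDegree_counterexample] at hi
  rcases Nat.lt_succ_iff_lt_or_eq.mp hi with h | h
  · -- 0 < i < p : common root 0
    refine ⟨0, ?_, ?_⟩
    · simp only [eval_sub, eval_pow, eval_X]
      rw [zero_pow (by omega), zero_pow (by omega), sub_zero]
    · simp only [map_sub, hasseDeriv_X_pow, eval_sub, eval_mul, eval_C, eval_pow, eval_X]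
      rw [zero_pow (by omega), zero_pow (by omega), mul_zero, mul_zero, sub_zero]
  · -- i = p : common root 1
    subst h
    refine ⟨1, ?_, ?_⟩
    · simp
    · simp only [map_sub, hasseDeriv_X_pow, eval_sub, eval_mul, eval_C, eval_pow, eval_X, one_pow,
        mul_one, Nat.choose_self, Nat.choose_succ_self_right, Nat.cast_succ, CharP.cast_eq_zero K i, Nat.cast_zero,
        zero_add, sub_self]

/-- CA FAILS in degree `p + 1` over every field of characteristic `p`. [cite: GrafVonBothmerEtAl2007, Prop. 7] -/
theorem not_holdsInDegree_prime_succ : ¬ HoldsInDegree K (p + 1) := by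
  have hp : p.Prime := Fact.out
  intro h
  obtain ⟨a, ha⟩ := h _ (monic_counterexample K p) (natDegree_counterexample K p) (isCasasAlvero_counterexample K p)
  have h0 := congrArg (eval 0) ha
  simp only [eval_sub, eval_pow, eval_X, zero_pow hp.ne_zero, zero_pow (Nat.succ_ne_zero p), sub_zero, eval_C,
    zero_sub] at h0
  have ha0 : a = 0 := by
    have := (pow_eq_zero_iff (Nat.succ_ne_zero p)).mp h0.symm
    exact neg_eq_zero.mp this
  rw [ha0, map_zero, sub_zero, sub_eq_self] at ha
  exact pow_ne_zero p X_ne_zero ha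

end Literature.Algebra.Polynomial.CasasAlvero
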